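import Summits.AtomisticToContinuum.HydrodynamicLimit.Theorems.InformationPercolationEngineChaosClosesEulerEnskogTensor
import Literature.MathematicalPhysics.KineticTheory.KineticEntropyBalanceFunctional
import Literature.MathematicalPhysics.KineticTheory.EvenStatTruncationBound
import HarnessLib

/-!
# `EvenStressEnskog` + weak stress isotropy ⇒ the collisional pressure value — part A: one-configuration algebra

Helper for the line `Sketch` of the crux `JParityClosure.ParityBandClosure` (stmt-AtomisticToContinuum-17608), stub
`stub_pressureValueOfEvenStress`.  For ONE configuration `w` of `N + 1` spheres, one cone scale `r` and one centre `x`,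
the Enskog prediction of `EvenStressEnskog` summed against a test matrix `A` is computed exactly:

* `sphereMark_evenMark_eq` — the Enskog tensor identity (landed `ChaosClosesEulerEnskogTensor.stub_enskogTensorIdentity`,
  Chapman–Cowling §16.4) in the vocabulary of `EvenCollisionTubeFunctional`:
  `Θ(Ξ_P^{kl})(v, w) = (2π/15)(‖w − v‖² δ_{kl} + 2 (w − v)_k (w − v)_l)`;
* `pairFunctional_evenMark_eq` — hence `B_r(Ξ_P^{kl}) = (4π/15)(δ_{kl}(2ρ_r e_r − ‖m_r‖²) + 2(ρ_r S_{kl} − m_k m_l))`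
  with `S` the cone-mollified second velocity moment (finite double sums over the particles);
* `sum_mul_pairFunctional_evenMark_eq` — `Σ_{kl} A_{kl} B_r(Ξ_P^{kl}) = (4π/9) tr A (2ρ_r e_r − ‖m_r‖²)
  + (8π/15) Σ_{kl} A⁰_{kl}(ρ_r S_{kl} − m_k m_l)`, `A⁰` the traceless part of `A`;
* the bridges to the integrands of the sister waypoints: `2(p_hs(ρ_r, θ_r) − ρ_r θ_r) = 2σ³ (2π/3) Y(σ³ρ_r) ρ_r²θ_r`
  (DEFINITION of `hsCompressibility`), `ρ_r² θ_r = (2ρ_r e_r − ‖m_r‖²)/3` and `ρ_r P_{kl} = ρ_r S_{kl} − m_k m_l`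
  (`P = S − m⊗m/ρ_r` the central tensor, junk branch `ρ_r = 0` included), and the replacement of the contact value `Y` by any function
  agreeing with it on a band `(0, η₁)` under a cut-off `g` vanishing on `[η₀', ∞)`, `η₀' ≤ η₁`;
* `stub_pressureValuePointwise` — the resulting POINTWISE identity
  `Σ_{kl} σ³ A_{kl} g Y B_r(Ξ_P^{kl}) = 2 g (p_hs − ρ_rθ_r) tr A + (8π/15) g̃(σ³ρ_r) Σ_{kl} A⁰_{kl} P_{kl}`,
  `g̃(b) = b⁺ g(b) Ỹ(b)` — registered sub-goal of the stub.

References: S. Chapman, T. G. Cowling, *The Mathematical Theory of Non-uniform Gases* (1970) §16.4; H. van Beijeren,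
M. H. Ernst, Physica 68 (1973) 437 (the Enskog collisional momentum flux `ρθ(Z − 1)𝟙 = ρ²θ σ³ f_ex′ 𝟙`).
-/

noncomputable section

namespace Summit.AtomisticToContinuum.HydrodynamicLimit.Theorems.ParityBandClosurePressureValue

open scoped BigOperators InnerProductSpace ENNReal
open MeasureTheory Set
open Literature.MathematicalPhysics.KineticTheory Literature.Analysis.FluidPDE

variable {N : ℕ}

/-! ## The traceless part and the finite-sum forms -/

/-- The traceless part `A⁰_{jk} = A_{jk} − δ_{jk} tr A / 3` of a `3 × 3` matrix is traceless. [folklore] -/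
theorem sum_traceless_diag (A : Fin 3 → Fin 3 → ℝ) : ∑ j, (A j j - if j = j then (∑ i, A i i) / 3 else 0) = 0 := by
  simp only [if_true, Finset.sum_sub_distrib, Finset.sum_const, Finset.card_univ, Fintype.card_fin]
  ring

/-- The cone-mollified second velocity moment `S_{jk}(x) = ∫ b_r(y, x) v_j v_k dμ_w(y, v)` (verbatim the first term
of the central tensor `Pm` of the sister waypoint `WeakStressIsotropyInBand`) as a finite sum:
`S_{jk} = (N+1)⁻¹ Σᵢ b_r(xᵢ, x) v_{ij} v_{ik}`. [folklore] -/
theorem secondMoment_eq_sum (r : ℝ) (w : Config (N + 1) (Fin 3) T3) (x : T3) (j k : Fin 3) :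
    (∫ q, coneKernel r q.1 x * (q.2 j * q.2 k) ∂(empiricalMeasure w)) =
      ((N + 1 : ℕ) : ℝ)⁻¹ * ∑ i, coneKernel r (w i).1 x * ((w i).2 j * (w i).2 k) := by
  rw [integral_empiricalMeasure]

/-- `m_r = (N+1)⁻¹ Σᵢ b_r(xᵢ, x) vᵢ` (local copy of the S6a lemma `mollMomentum_eq_sum`). [folklore] -/
theorem mollMomentum_eq_sum' (r : ℝ) (w : Config (N + 1) (Fin 3) T3) (x : T3) :
    mollMomentum r w x = ((N + 1 : ℕ) : ℝ)⁻¹ • ∑ i, coneKernel r (w i).1 x • (w i).2 := by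
  unfold mollMomentum
  rw [empiricalMeasure_eq, integral_smul_measure, integral_finsetSum_measure]
  · simp only [integral_dirac, ENNReal.toReal_inv, ENNReal.toReal_natCast]
  · exact fun i _ => integrable_dirac (by simp)

/-- Components of the mollified momentum: `(m_r)_k = (N+1)⁻¹ Σᵢ b_r(xᵢ, x) v_{ik}`. [folklore] -/
theorem mollMomentum_apply_eq_sum (r : ℝ) (w : Config (N + 1) (Fin 3) T3) (x : T3) (k : Fin 3) :
    mollMomentum r w x k = ((N + 1 : ℕ) : ℝ)⁻¹ * ∑ i, coneKernel r (w i).1 x * (w i).2 k := by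
  rw [mollMomentum_eq_sum']
  simp [Finset.sum_apply, smul_eq_mul]

/-- `‖x‖² = Σ_k x_k²` on `ℝ³`. [folklore] -/
theorem norm_sq_eq_sum (x : V3) : ‖x‖ ^ 2 = ∑ k, x k ^ 2 := by
  rw [EuclideanSpace.norm_eq, Real.sq_sqrt (Finset.sum_nonneg fun _ _ => by positivity)]
  simp [Real.norm_eq_abs, sq_abs]

/-- `Σ_k S_{kk} = 2 e_r`. [folklore] -/
theorem sum_secondMoment_diag (r : ℝ) (w : Config (N + 1) (Fin 3) T3) (x : T3) :
    ∑ k, (∫ q, coneKernel r q.1 x * (q.2 k * q.2 k) ∂(empiricalMeasure w)) = 2 * mollKineticEnergy r w x := by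
  simp_rw [secondMoment_eq_sum, mollKineticEnergy_eq_sum]
  rw [← Finset.mul_sum, Finset.sum_comm]
  simp_rw [← Finset.mul_sum, ← pow_two, ← norm_sq_eq_sum]
  rw [Finset.mul_sum, Finset.mul_sum, Finset.mul_sum]
  refine Finset.sum_congr rfl fun i _ => ?_
  ring

/-- `Σ_k (m_r)_k² = ‖m_r‖²`. [folklore] -/
theorem sum_mollMomentum_sq (r : ℝ) (w : Config (N + 1) (Fin 3) T3) (x : T3) :
    ∑ k, mollMomentum r w x k ^ 2 = ‖mollMomentum r w x‖ ^ 2 :=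
  (norm_sq_eq_sum _).symm

/-! ## The Enskog tensor identity in the vocabulary of the even marks -/

/-- **`Θ(Ξ_P^{kl})(v, w) = (2π/15)(‖w − v‖² δ_{kl} + 2 (w − v)_k (w − v)_l)`** — the landed Enskog tensor identity
`∫_{S²} (g·ω)₊² ω_kω_l dω = (2π/15)(|g|²δ_{kl} + 2 g_kg_l)` read with `g = w − v`
(`hardSphereKernel (w, v) ω = ((w − v)·ω)₊`). [cite: ChapmanCowling1970, §16.4] -/
theorem sphereMark_evenMark_eq (k l : Fin 3) (v w : V3) :
    sphereMark (evenMark k l) v w =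
      2 * Real.pi / 15 * (‖w - v‖ ^ 2 * (if k = l then 1 else 0) + 2 * ((w - v) k * (w - v) l)) := by
  unfold sphereMark
  rw [← ChaosClosesEulerEnskogTensor.stub_enskogTensorIdentity (w - v) k l]
  refine integral_congr_ae (ae_of_all _ fun ω => ?_)
  simp only [evenMark, hardSphereKernel]
  ring

/-- The basic double-sum identity: `(N+1)⁻² Σᵢ Σⱼ bᵢ bⱼ (vⱼ − vᵢ)_k (vⱼ − vᵢ)_l = 2(ρ_r S_{kl} − m_k m_l)`. [folklore] -/
theorem double_sum_sub_mul_sub_eq (r : ℝ) (w : Config (N + 1) (Fin 3) T3) (x : T3) (k l : Fin 3) :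
    ((N + 1 : ℕ) : ℝ)⁻¹ * ((N + 1 : ℕ) : ℝ)⁻¹ *
        ∑ i, ∑ j, coneKernel r (w i).1 x * coneKernel r (w j).1 x *
          (((w j).2 - (w i).2) k * ((w j).2 - (w i).2) l) =
      2 * (mollDensity r w x * (∫ q, coneKernel r q.1 x * (q.2 k * q.2 l) ∂(empiricalMeasure w)) - mollMomentum r w x k * mollMomentum r w x l) := by
  rw [mollDensity_eq_avg, secondMoment_eq_sum, mollMomentum_apply_eq_sum, mollMomentum_apply_eq_sum]
  set c : ℝ := ((N + 1 : ℕ) : ℝ)⁻¹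
  set b : Fin (N + 1) → ℝ := fun i => coneKernel r (w i).1 x with hb
  set v : Fin (N + 1) → Fin 3 → ℝ := fun i m => (w i).2 m with hv
  have hterm : ∀ i j, coneKernel r (w i).1 x * coneKernel r (w j).1 x *
      (((w j).2 - (w i).2) k * ((w j).2 - (w i).2) l) =
        b i * (b j * (v j k * v j l)) - (b i * v i l) * (b j * v j k) - (b i * v i k) * (b j * v j l)
          + (b i * (v i k * v i l)) * b j := by
    intro i j
    simp only [hb, hv, PiLp.sub_apply]
    ring
  simp_rw [hterm]
  simp only [Finset.sum_add_distrib, Finset.sum_sub_distrib, ← Finset.mul_sum, ← Finset.sum_mul]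
  simp only [hb, hv]
  ring

/-- `(N+1)⁻² Σᵢ Σⱼ bᵢ bⱼ ‖vⱼ − vᵢ‖² = 2(2ρ_r e_r − ‖m_r‖²)`. [folklore] -/
theorem double_sum_norm_sub_sq_eq (r : ℝ) (w : Config (N + 1) (Fin 3) T3) (x : T3) :
    ((N + 1 : ℕ) : ℝ)⁻¹ * ((N + 1 : ℕ) : ℝ)⁻¹ *
        ∑ i, ∑ j, coneKernel r (w i).1 x * coneKernel r (w j).1 x * ‖(w j).2 - (w i).2‖ ^ 2 =
      2 * (2 * mollDensity r w x * mollKineticEnergy r w x - ‖mollMomentum r w x‖ ^ 2) := by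
  set F : Fin (N + 1) → Fin (N + 1) → Fin 3 → ℝ := fun i j k =>
    coneKernel r (w i).1 x * coneKernel r (w j).1 x * (((w j).2 - (w i).2) k * ((w j).2 - (w i).2) k) with hF
  have h : ∀ i j, coneKernel r (w i).1 x * coneKernel r (w j).1 x * ‖(w j).2 - (w i).2‖ ^ 2 = ∑ k, F i j k := by
    intro i j
    rw [norm_sq_eq_sum, Finset.mul_sum]
    refine Finset.sum_congr rfl fun k _ => ?_
    simp only [hF]
    ring
  simp_rw [h]
  have hcomm : (∑ i, ∑ j, ∑ k, F i j k) = ∑ k, ∑ i, ∑ j, F i j k :=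
    calc (∑ i, ∑ j, ∑ k, F i j k) = ∑ i, ∑ k, ∑ j, F i j k := Finset.sum_congr rfl fun i _ => Finset.sum_comm
      _ = ∑ k, ∑ i, ∑ j, F i j k := Finset.sum_comm
  rw [hcomm, Finset.mul_sum]
  have hk : ∀ k, ((N + 1 : ℕ) : ℝ)⁻¹ * ((N + 1 : ℕ) : ℝ)⁻¹ * ∑ i, ∑ j, F i j k =
      2 * (mollDensity r w x * (∫ q, coneKernel r q.1 x * (q.2 k * q.2 k) ∂(empiricalMeasure w)) - mollMomentum r w x k * mollMomentum r w x k) :=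
    fun k => double_sum_sub_mul_sub_eq r w x k k
  simp_rw [hk]
  rw [← Finset.mul_sum, Finset.sum_sub_distrib, ← Finset.mul_sum, sum_secondMoment_diag]
  simp_rw [← pow_two]
  rw [sum_mollMomentum_sq]
  ring

/-- **The pair functional of the even marks, exactly**:
`B_r(Ξ_P^{kl}) = (4π/15)(δ_{kl}(2ρ_r e_r − ‖m_r‖²) + 2(ρ_r S_{kl} − m_k m_l))`. [folklore] -/
theorem pairFunctional_evenMark_eq (r : ℝ) (w : Config (N + 1) (Fin 3) T3) (x : T3) (k l : Fin 3) :
    pairFunctional r (evenMark k l) w x =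
      4 * Real.pi / 15 * ((if k = l then 1 else 0) * (2 * mollDensity r w x * mollKineticEnergy r w x -
          ‖mollMomentum r w x‖ ^ 2) +
        2 * (mollDensity r w x * (∫ q, coneKernel r q.1 x * (q.2 k * q.2 l) ∂(empiricalMeasure w)) - mollMomentum r w x k * mollMomentum r w x l)) := by
  rw [pairFunctional_eq_double_sum]
  simp_rw [sphereMark_evenMark_eq]
  have h1 := double_sum_sub_mul_sub_eq r w x k l
  have h2 := double_sum_norm_sub_sq_eq r w x
  set c : ℝ := ((N + 1 : ℕ) : ℝ)⁻¹
  have hsplit : ∑ i, ∑ j, coneKernel r (w i).1 x * coneKernel r (w j).1 x *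
      (2 * Real.pi / 15 * (‖(w j).2 - (w i).2‖ ^ 2 * (if k = l then 1 else 0) +
        2 * (((w j).2 - (w i).2) k * ((w j).2 - (w i).2) l))) =
      2 * Real.pi / 15 * ((if k = l then 1 else 0) *
        ∑ i, ∑ j, coneKernel r (w i).1 x * coneKernel r (w j).1 x * ‖(w j).2 - (w i).2‖ ^ 2 +
        2 * ∑ i, ∑ j, coneKernel r (w i).1 x * coneKernel r (w j).1 x *
          (((w j).2 - (w i).2) k * ((w j).2 - (w i).2) l)) := by
    simp only [Finset.mul_sum, ← Finset.sum_add_distrib]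
    refine Finset.sum_congr rfl fun i _ => Finset.sum_congr rfl fun j _ => ?_
    ring
  rw [hsplit]
  have e1 : c * c * (2 * Real.pi / 15 * ((if k = l then 1 else 0) *
        ∑ i, ∑ j, coneKernel r (w i).1 x * coneKernel r (w j).1 x * ‖(w j).2 - (w i).2‖ ^ 2 +
        2 * ∑ i, ∑ j, coneKernel r (w i).1 x * coneKernel r (w j).1 x *
          (((w j).2 - (w i).2) k * ((w j).2 - (w i).2) l))) =
      2 * Real.pi / 15 * ((if k = l then 1 else 0) *
        (c * c * ∑ i, ∑ j, coneKernel r (w i).1 x * coneKernel r (w j).1 x * ‖(w j).2 - (w i).2‖ ^ 2) +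
        2 * (c * c * ∑ i, ∑ j, coneKernel r (w i).1 x * coneKernel r (w j).1 x *
          (((w j).2 - (w i).2) k * ((w j).2 - (w i).2) l))) := by ring
  rw [e1, h1, h2]
  ring

/-- **The summed pair functional**: for every matrix `A`,
`Σ_{kl} A_{kl} B_r(Ξ_P^{kl}) = (4π/9) tr A (2ρ_r e_r − ‖m_r‖²) + (8π/15) Σ_{kl} A⁰_{kl} (ρ_r S_{kl} − m_k m_l)`. [folklore] -/
theorem sum_mul_pairFunctional_evenMark_eq (A : Fin 3 → Fin 3 → ℝ) (r : ℝ) (w : Config (N + 1) (Fin 3) T3) (x : T3) :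
    ∑ k, ∑ l, A k l * pairFunctional r (evenMark k l) w x =
      4 * Real.pi / 9 * (∑ k, A k k) * (2 * mollDensity r w x * mollKineticEnergy r w x - ‖mollMomentum r w x‖ ^ 2) +
      8 * Real.pi / 15 * ∑ k, ∑ l, (A k l - if k = l then (∑ i, A i i) / 3 else 0) *
        (mollDensity r w x * (∫ q, coneKernel r q.1 x * (q.2 k * q.2 l) ∂(empiricalMeasure w)) - mollMomentum r w x k * mollMomentum r w x l) := by
  simp_rw [pairFunctional_evenMark_eq]
  have hS := sum_secondMoment_diag r w x
  have hm := sum_mollMomentum_sq r w x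
  simp only [Fin.sum_univ_three, Fin.isValue] at hS hm ⊢
  simp
  linear_combination (8 * Real.pi / 45) * (A 0 0 + A 1 1 + A 2 2) * (mollDensity r w x * hS - hm)

/-! ## The junk branch `ρ_r = 0` and the thermodynamic bridges -/

/-- The cone kernel is nonnegative (`0 < r`). [folklore] -/
theorem coneKernel_nonneg' {r : ℝ} (hr : 0 < r) (y x : T3) : 0 ≤ coneKernel r y x := by
  unfold coneKernel
  exact mul_nonneg (by positivity) (le_max_right _ _)

/-- Where `ρ_r(x) = 0` every cone weight `b_r(xᵢ, x)` vanishes (they are nonnegative). [folklore] -/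
theorem coneKernel_eq_zero_of_mollDensity_eq_zero {r : ℝ} (hr : 0 < r) {w : Config (N + 1) (Fin 3) T3} {x : T3}
    (hρ : mollDensity r w x = 0) (i : Fin (N + 1)) : coneKernel r (w i).1 x = 0 := by
  rw [mollDensity_eq_avg] at hρ
  have hc : (0 : ℝ) < ((N + 1 : ℕ) : ℝ)⁻¹ := by positivity
  have hsum : ∑ j, coneKernel r (w j).1 x = 0 := by
    rcases mul_eq_zero.1 hρ with h | h
    · exact absurd h hc.ne'
    · exact h
  exact (Finset.sum_eq_zero_iff_of_nonneg fun j _ => coneKernel_nonneg' hr (w j).1 x).1 hsum i (Finset.mem_univ i)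

/-- `ρ_r = 0 ⇒ m_r = 0`. [folklore] -/
theorem mollMomentum_eq_zero_of_mollDensity_eq_zero {r : ℝ} (hr : 0 < r) {w : Config (N + 1) (Fin 3) T3} {x : T3}
    (hρ : mollDensity r w x = 0) : mollMomentum r w x = 0 := by
  rw [mollMomentum_eq_sum']
  simp [coneKernel_eq_zero_of_mollDensity_eq_zero hr hρ]

/-- `ρ_r = 0 ⇒ B_r Ξ = 0` for every mark. [folklore] -/
theorem pairFunctional_eq_zero_of_mollDensity_eq_zero' {r : ℝ} (hr : 0 < r) (Ξ : V3 × V3 × V3 → ℝ)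
    {w : Config (N + 1) (Fin 3) T3} {x : T3} (hρ : mollDensity r w x = 0) : pairFunctional r Ξ w x = 0 := by
  rw [pairFunctional_eq_double_sum]
  simp [coneKernel_eq_zero_of_mollDensity_eq_zero hr hρ]

/-- **`ρ_r² θ_r = (2ρ_r e_r − ‖m_r‖²)/3` identically** (junk branch `ρ_r = 0`: both sides vanish). [folklore] -/
theorem mollDensity_sq_mul_mollTemperature {r : ℝ} (hr : 0 < r) (w : Config (N + 1) (Fin 3) T3) (x : T3) :
    mollDensity r w x ^ 2 * mollTemperature r w x =
      (2 * mollDensity r w x * mollKineticEnergy r w x - ‖mollMomentum r w x‖ ^ 2) / 3 := by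
  unfold mollTemperature
  by_cases hρ : mollDensity r w x = 0
  · rw [mollMomentum_eq_zero_of_mollDensity_eq_zero hr hρ, hρ]
    simp
  · field_simp

/-- **`ρ_r P_{jk} = ρ_r S_{jk} − m_j m_k` identically** (junk branch `ρ_r = 0`: both sides vanish). [folklore] -/
theorem mollDensity_mul_centralMoment {r : ℝ} (hr : 0 < r) (w : Config (N + 1) (Fin 3) T3) (x : T3) (j k : Fin 3) :
    mollDensity r w x * ((∫ q, coneKernel r q.1 x * (q.2 j * q.2 k) ∂(empiricalMeasure w)) - mollMomentum r w x j * mollMomentum r w x k / mollDensity r w x) =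
      mollDensity r w x * (∫ q, coneKernel r q.1 x * (q.2 j * q.2 k) ∂(empiricalMeasure w)) - mollMomentum r w x j * mollMomentum r w x k := by
  by_cases hρ : mollDensity r w x = 0
  · rw [mollMomentum_eq_zero_of_mollDensity_eq_zero hr hρ, hρ]
    simp
  · rw [mul_sub, mul_div_cancel₀ _ hρ]

/-- **The excess pressure is the contact value, by DEFINITION of `hsCompressibility`**:
`p_hs(σ; ρ, θ) − ρθ = σ³ · (2π/3) Y(σ³ρ) · ρ²θ` (`Z(η) = 1 + η f_ex′(η)`, `Y = (3/2π) f_ex′`). [folklore] -/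
theorem hsPressure_sub_eq (σ ρ θ : ℝ) :
    hsPressure σ ρ θ - ρ * θ = σ ^ 3 * (2 * Real.pi / 3 * contactValue (σ ^ 3 * ρ)) * (ρ ^ 2 * θ) := by
  unfold hsPressure hsCompressibility contactValue
  rw [mul_comm ρ (σ ^ 3)]
  field_simp
  ring

/-- **Band replacement of the contact value.** If `Ỹ = Y` on `(0, η₁)` and the cut-off `g` vanishes on `[η₀', ∞)`,
`η₀' ≤ η₁`, then `g(b) Y(b) P = g(b) Ỹ(b) P` for every `b ≥ 0` and every factor `P` vanishing at `b = 0`. [folklore] -/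
theorem cutoff_mul_contactValue_mul_eq {Yt g : ℝ → ℝ} {η₀' η₁ : ℝ} (hY : ∀ b ∈ Ioo 0 η₁, Yt b = contactValue b)
    (hg : ∀ b, η₀' ≤ b → g b = 0) (hle : η₀' ≤ η₁) {b P : ℝ} (hb : 0 ≤ b) (hP : b = 0 → P = 0) :
    g b * contactValue b * P = g b * Yt b * P := by
  rcases hb.eq_or_lt with h | h
  · rw [hP h.symm, mul_zero, mul_zero]
  · by_cases hlt : b < η₀'
    · rw [hY b ⟨h, hlt.trans_le hle⟩]
    · rw [hg b (not_lt.1 hlt), zero_mul, zero_mul, zero_mul, zero_mul]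

/-! ## The pointwise identity (registered sub-goal) -/

/-- **REGISTERED SUB-GOAL `stub_pressureValuePointwise`** of `stub_pressureValueOfEvenStress`: for one configuration
`w`, one centre `x`, a test matrix `A`, a cut-off `g` vanishing on `[η₀', ∞)` and a function `Ỹ` equal to the contact
value `Y` on `(0, η₁) ⊇ (0, η₀')`, the Enskog prediction of `EvenStressEnskog` summed against `A` splits EXACTLY into the
pressure-value integrand of `CollisionalPressureValueInBand` (trace part, `2(p_hs − ρ_rθ_r) tr A`) plus `8π/15` times
the weak-isotropy integrand of `WeakStressIsotropyInBand` for the traceless part `A⁰` and the cut-off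
`b ↦ b⁺ g(b) Ỹ(b)`. [folklore] -/
theorem stub_pressureValuePointwise : ∀ {N : ℕ} {Yt g : ℝ → ℝ} {η₀' η₁ σ r : ℝ}, (∀ b ∈ Set.Ioo 0 η₁, Yt b = contactValue b) → (∀ b, η₀' ≤ b → g b = 0) → η₀' ≤ η₁ → 0 < σ → 0 < r → ∀ (A : Fin 3 → Fin 3 → ℝ) (w : Config (N + 1) (Fin 3) T3) (x : T3), (∑ k, ∑ l, σ ^ 3 * (A k l * g (σ ^ 3 * mollDensity r w x) * contactValue (σ ^ 3 * mollDensity r w x) * pairFunctional r (evenMark k l) w x)) = 2 * (g (σ ^ 3 * mollDensity r w x) * (hsPressure σ (mollDensity r w x) (mollTemperature r w x) - mollDensity r w x * mollTemperature r w x) * ∑ k, A k k) + 8 * Real.pi / 15 * (max (σ ^ 3 * mollDensity r w x) 0 * g (σ ^ 3 * mollDensity r w x) * Yt (σ ^ 3 * mollDensity r w x) * ∑ j, ∑ k, (A j k - if j = k then (∑ i, A i i) / 3 else 0) * ((∫ q, coneKernel r q.1 x * (q.2 j * q.2 k) ∂(empiricalMeasure w)) - mollMomentum r w x j * mollMomentum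 r w x k / mollDensity r w x)) := by
  intro N Yt g η₀' η₁ σ r hY hg hle hσ hr A w x
  have hρ0 : 0 ≤ mollDensity r w x := mollDensity_nonneg_of_pos hr w x
  have hb : 0 ≤ σ ^ 3 * mollDensity r w x := mul_nonneg (pow_nonneg hσ.le 3) hρ0
  have hbz : σ ^ 3 * mollDensity r w x = 0 → mollDensity r w x = 0 := fun h => by
    rcases mul_eq_zero.1 h with h | h
    · exact absurd h (pow_ne_zero 3 hσ.ne')
    · exact h
  have hD0 : σ ^ 3 * mollDensity r w x = 0 →
      2 * mollDensity r w x * mollKineticEnergy r w x - ‖mollMomentum r w x‖ ^ 2 = 0 := fun h => by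
    rw [mollMomentum_eq_zero_of_mollDensity_eq_zero hr (hbz h), hbz h]
    simp
  -- Step 1: band replacement in every summand and factorisation
  have h1 : ∀ k l, σ ^ 3 * (A k l * g (σ ^ 3 * mollDensity r w x) * contactValue (σ ^ 3 * mollDensity r w x) *
      pairFunctional r (evenMark k l) w x) =
      σ ^ 3 * (g (σ ^ 3 * mollDensity r w x) * Yt (σ ^ 3 * mollDensity r w x)) *
        (A k l * pairFunctional r (evenMark k l) w x) := by
    intro k l
    have hc := cutoff_mul_contactValue_mul_eq hY hg hle hb (P := pairFunctional r (evenMark k l) w x)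
      (fun h => pairFunctional_eq_zero_of_mollDensity_eq_zero' hr _ (hbz h))
    calc _ = σ ^ 3 * A k l * (g (σ ^ 3 * mollDensity r w x) * contactValue (σ ^ 3 * mollDensity r w x) *
          pairFunctional r (evenMark k l) w x) := by ring
      _ = σ ^ 3 * A k l * (g (σ ^ 3 * mollDensity r w x) * Yt (σ ^ 3 * mollDensity r w x) *
          pairFunctional r (evenMark k l) w x) := by rw [hc]
      _ = _ := by ring
  simp_rw [h1, ← Finset.mul_sum]
  rw [sum_mul_pairFunctional_evenMark_eq]
  -- Step 2: the trace part
  have h2 : g (σ ^ 3 * mollDensity r w x) *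
      (hsPressure σ (mollDensity r w x) (mollTemperature r w x) - mollDensity r w x * mollTemperature r w x) =
      σ ^ 3 * (g (σ ^ 3 * mollDensity r w x) * Yt (σ ^ 3 * mollDensity r w x)) *
        (2 * Real.pi / 9 * (2 * mollDensity r w x * mollKineticEnergy r w x - ‖mollMomentum r w x‖ ^ 2)) := by
    rw [hsPressure_sub_eq, mollDensity_sq_mul_mollTemperature hr]
    have hc := cutoff_mul_contactValue_mul_eq hY hg hle hb
      (P := 2 * mollDensity r w x * mollKineticEnergy r w x - ‖mollMomentum r w x‖ ^ 2) hD0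
    calc _ = σ ^ 3 * (2 * Real.pi / 9) * (g (σ ^ 3 * mollDensity r w x) * contactValue (σ ^ 3 * mollDensity r w x) *
          (2 * mollDensity r w x * mollKineticEnergy r w x - ‖mollMomentum r w x‖ ^ 2)) := by ring
      _ = σ ^ 3 * (2 * Real.pi / 9) * (g (σ ^ 3 * mollDensity r w x) * Yt (σ ^ 3 * mollDensity r w x) *
          (2 * mollDensity r w x * mollKineticEnergy r w x - ‖mollMomentum r w x‖ ^ 2)) := by rw [hc]
      _ = _ := by ring
  -- Step 3: the traceless part
  have h3 : max (σ ^ 3 * mollDensity r w x) 0 * g (σ ^ 3 * mollDensity r w x) * Yt (σ ^ 3 * mollDensity r w x) *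
      ∑ j, ∑ k, (A j k - if j = k then (∑ i, A i i) / 3 else 0) * ((∫ q, coneKernel r q.1 x * (q.2 j * q.2 k) ∂(empiricalMeasure w)) - mollMomentum r w x j * mollMomentum r w x k / mollDensity r w x) =
      σ ^ 3 * (g (σ ^ 3 * mollDensity r w x) * Yt (σ ^ 3 * mollDensity r w x)) *
        ∑ j, ∑ k, (A j k - if j = k then (∑ i, A i i) / 3 else 0) *
          (mollDensity r w x * (∫ q, coneKernel r q.1 x * (q.2 j * q.2 k) ∂(empiricalMeasure w)) - mollMomentum r w x j * mollMomentum r w x k) := by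
    rw [max_eq_left hb]
    simp_rw [← mollDensity_mul_centralMoment hr, Finset.mul_sum]
    refine Finset.sum_congr rfl fun j _ => Finset.sum_congr rfl fun k _ => ?_
    ring
  rw [h2, h3]
  ring

end Summit.AtomisticToContinuum.HydrodynamicLimit.Theorems.ParityBandClosurePressureValue

end
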